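import Literature.MathematicalPhysics.QuantumFieldTheory.Balaban1983to89.T3ContinuumYM3Torus
import HarnessLib

/-!
# Route `UnitScaleTilt`, crux K1 child «MinimiserStabilityRegPr» (stmt-QuantumFields-19200), leaf V2′ `stub_halvingStep` — PILLAR F4, PART 4
# (the F3 ⟶ F4 junction): **A REAL SCALAR FLAT OPERATOR ACTS COMPONENTWISE ON 𝔤ᶜ-VALUED FIELDS WITH THE SAME LETTERS** —
# [Balaban1985Variational] p. 288: *«we have suppressed matrix indices of operators acting on the Lie algebra valued functions»*; p. 302:
# *«all the operators in this section are taken without any external gauge field configuration … These operators were considered in [2,3]»*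

Cell `ym3-torus` (HUMAN RULING D-0037, YM ladder rung R3), seat `ym-ust-19200-f4` gen 0.  `--supports stmt-QuantumFields-19200 --as helper`;
count-neutral; fourth file of pillar F4.

WHY.  Pillar F3 (ym3-torus-p1 g14: `FlatPropagatorSup.abs_GE_le_sup_T3`, `FlatPropagatorGrad.grad_lap_GE_le_of_ineq110`,
`FlatMinimizerH.exists_flatH_T3`) delivers the FLAT operators `G`, `H` of [2,3] as operators on REAL SCALAR bond fields `PBond P j → ℝ` with the
letters `|Gx| ≤ C·β`, `L^j·|(Gx)(⟨s+e_ν,μ⟩) − (Gx)(⟨s,μ⟩)| ≤ C·β` for `|x| ≤ β`.  Pillar F4 (`FlatSmallSolution158.existsUnique_smallSolution158_T3`,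
`FlatChart47.chart47_T3`) consumes ℂ-LINEAR operators on `V`-valued fields (`V = 𝔤ᶜ`) with the same letters in `‖·‖`.  The flat operators
of Sect. F act on 𝔤ᶜ-valued fields COMPONENTWISE (p. 288), i.e. as `g ⊗ id_V`: `(G_V A)(b) = Σ_{b′} k(b, b′)·A(b′)` with the real kernel
`k(b, b′) = (g e_{b′})(b)`.  THIS FILE proves, once and for all finite index types, that every LETTER of `g` (a real linear combination of
values of `gx` bounded by `C` on the unit sup-ball) transfers to `G_V` with the same constant — by the sign trick `Σ_{b′}|m(b′)| = Σ_{b′} m(b′)·sgn m(b′)`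
— and that composition / right-inverse identities (`Q ∘ H = id`, `Q ∘ G̃ = 0`) transfer too.

WHAT IS PROVED (sorry-free; no definition; axioms standard; Mathlib only + the T³ family for §3).  For finite `ι`, `κ`, a real-linear
`g : (ι → ℝ) →ₗ[ℝ] (κ → ℝ)`, and any complex normed space `V`:
* §1 `exists_extension` — the componentwise extension `G_V : (ι → V) →ₗ[ℂ] (κ → V)`, `(G_V A)(b) = Σ_i (g(e_i))(b)·A(i)` (`e_i = Pi.single i 1`),
  as an existence statement; `extension_apply_real_smul` (`G_V(x·v) = (gx)·v`: it IS `g` on each component); `extension_comp`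
  (`(q ∘ g)_V = q_V ∘ G_V`), **`extension_rightInverse`** (`q(gx) = x ⇒ q_V(G_V A) = A` — (45) `Q(HB) = B` transfers), `extension_comp_eq_zero`
  (`q ∘ g = 0 ⇒ q_V ∘ G_V = 0` — «Q𝔊 = 0» transfers).
* §2 **`letter_extension_le`** — THE TRANSFER OF AN ARBITRARY LETTER: if `|Σ_b λ_b·(gx)(b)| ≤ C` for all real `x` with `|x| ≤ 1`, then
  `‖Σ_b λ_b·(G_V A)(b)‖ ≤ C·β` for all `A` with `‖A(i)‖ ≤ β`; corollaries `sup_extension_le` (`|Gx| ≤ Cβ ⇒ ‖G_V A‖ ≤ Cβ` pointwise) and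
  `diff_extension_le` (`c·|(gx)(b₁) − (gx)(b₀)| ≤ Cβ ⇒ c·‖(G_V A)(b₁) − (G_V A)(b₀)‖ ≤ Cβ`).
* §3 **`exists_extension_T3`** — AT THE d = 3 CARRIER: a real-linear operator `g` from level-`j₁` to level-`0` scalar bond fields of `F.P K` with
  p1 g14's two letters (sup, `L^{K−n}`-weighted forward difference) yields a ℂ-linear `G_V` on `V`-valued fields with the SAME two letters in
  the shape consumed by `existsUnique_smallSolution158_T3` / `chart47_T3`, agreeing with `g` componentwise.
HONEST SCOPE.  Pure finite-dimensional linear algebra ([folklore]); nothing of [2,3] is proved; which concrete `g` (print's `G̃ = GP₀* − …` of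
(143), `H` of (45)) is fed is the composition's choice; NOT a claim about the mass gap.

References: T. Bałaban, CMP **102** (1985) 277–309 [Balaban1985Variational] p.288 (after (66)), (45)–(46) p.285, Sect. F p.302.
-/

set_option autoImplicit false

noncomputable section

open scoped BigOperators

namespace Summit.QuantumFields.YangMills.Theorems.FlatScalarExtension

open Literature.MathematicalPhysics.QuantumFieldTheory.Balaban1983to89

section Generic

variable {ι κ : Type*} [Fintype ι] [DecidableEq ι]
variable {V : Type*} [NormedAddCommGroup V] [NormedSpace ℂ V]

/-! ## §1 The componentwise extension and its algebra -/

/-- **The componentwise (𝔤ᶜ-)extension of a real scalar operator** — `(G_V A)(b) = Σ_i (g e_i)(b)·A(i)`, a ℂ-linear map on `V`-valued fields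
(p. 288: *«we have suppressed matrix indices of operators acting on the Lie algebra valued functions»*), packaged as an existence statement.
[cite: Balaban1985Variational, p.288] -/
theorem exists_extension (g : (ι → ℝ) →ₗ[ℝ] (κ → ℝ)) (W : Type*) [AddCommGroup W] [Module ℂ W] :
    ∃ Gv : (ι → W) →ₗ[ℂ] (κ → W), ∀ (A : ι → W) (b : κ), Gv A b = ∑ i, ((g (Pi.single i 1) b : ℝ) : ℂ) • A i :=
  ⟨{ toFun := fun A b => ∑ i, ((g (Pi.single i 1) b : ℝ) : ℂ) • A i
     map_add' := fun A B => by
       funext b; simp only [Pi.add_apply, smul_add, Finset.sum_add_distrib]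
     map_smul' := fun z A => by
       funext b; simp only [Pi.smul_apply, RingHom.id_apply, Finset.smul_sum, smul_smul, mul_comm z] },
    fun _ _ => rfl⟩

/-- The kernel expansion of the scalar operator: `(gx)(b) = Σ_i x(i)·(g e_i)(b)`. [folklore] -/
theorem apply_eq_sum_kernel (g : (ι → ℝ) →ₗ[ℝ] (κ → ℝ)) (x : ι → ℝ) (b : κ) :
    g x b = ∑ i, x i * g (Pi.single i 1) b := by
  conv_lhs => rw [pi_eq_sum_univ' x, map_sum]
  rw [Finset.sum_apply]
  refine Finset.sum_congr rfl fun i _ => ?_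
  rw [map_smul, Pi.smul_apply, smul_eq_mul]

/-- **`G_V` IS `g` ON EACH COMPONENT**: `G_V(b ↦ x(b)·v) = (b ↦ (gx)(b)·v)` for real `x` and `v ∈ V`. [cite: Balaban1985Variational, p.288] -/
theorem extension_apply_real_smul (g : (ι → ℝ) →ₗ[ℝ] (κ → ℝ)) {Gv : (ι → V) →ₗ[ℂ] (κ → V)}
    (hGv : ∀ (A : ι → V) (b : κ), Gv A b = ∑ i, ((g (Pi.single i 1) b : ℝ) : ℂ) • A i) (x : ι → ℝ) (v : V) :
    Gv (fun i => ((x i : ℝ) : ℂ) • v) = fun b => ((g x b : ℝ) : ℂ) • v := by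
  funext b
  rw [hGv, apply_eq_sum_kernel g x b, Complex.ofReal_sum, Finset.sum_smul]
  refine Finset.sum_congr rfl fun i _ => ?_
  rw [smul_smul, Complex.ofReal_mul, mul_comm]

/-- **Functoriality**: the extension of a composite is the composite of the extensions, `(q ∘ g)_V = q_V ∘ G_V`. [folklore] -/
theorem extension_comp [Fintype κ] [DecidableEq κ] {τ : Type*} [Fintype τ] [DecidableEq τ] (g : (ι → ℝ) →ₗ[ℝ] (κ → ℝ)) (q : (κ → ℝ) →ₗ[ℝ] (τ → ℝ))
    {Gv : (ι → V) →ₗ[ℂ] (κ → V)} {Qv : (κ → V) →ₗ[ℂ] (τ → V)}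
    (hGv : ∀ (A : ι → V) (b : κ), Gv A b = ∑ i, ((g (Pi.single i 1) b : ℝ) : ℂ) • A i)
    (hQv : ∀ (B : κ → V) (t : τ), Qv B t = ∑ b, ((q (Pi.single b 1) t : ℝ) : ℂ) • B b) (A : ι → V) (t : τ) :
    Qv (Gv A) t = ∑ i, (((q.comp g) (Pi.single i 1) t : ℝ) : ℂ) • A i := by
  rw [hQv]
  simp_rw [hGv, Finset.smul_sum, smul_smul]
  rw [Finset.sum_comm]
  refine Finset.sum_congr rfl fun i _ => ?_
  rw [← Finset.sum_smul]
  congr 1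
  rw [LinearMap.comp_apply, apply_eq_sum_kernel q (g (Pi.single i 1)) t, Complex.ofReal_sum]
  refine Finset.sum_congr rfl fun b _ => ?_
  rw [Complex.ofReal_mul, mul_comm]

/-- **(45) TRANSFERS**: if `q(gx) = x` for all real `x` (e.g. `Q_j(Hb) = b`, pillar F3 `FlatMinimizerH.bondAvgIter_H_eq` with `Q_j` real-linear),
then `q_V(G_V A) = A` for all `V`-valued `A`. [cite: Balaban1985Variational, (45) p.285] -/
theorem extension_rightInverse [Fintype κ] [DecidableEq κ] {τ : Type*} [Fintype τ] [DecidableEq τ] (g : (τ → ℝ) →ₗ[ℝ] (κ → ℝ)) (q : (κ → ℝ) →ₗ[ℝ] (τ → ℝ))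
    {Gv : (τ → V) →ₗ[ℂ] (κ → V)} {Qv : (κ → V) →ₗ[ℂ] (τ → V)}
    (hGv : ∀ (A : τ → V) (b : κ), Gv A b = ∑ i, ((g (Pi.single i 1) b : ℝ) : ℂ) • A i)
    (hQv : ∀ (B : κ → V) (t : τ), Qv B t = ∑ b, ((q (Pi.single b 1) t : ℝ) : ℂ) • B b)
    (hqg : ∀ x, q (g x) = x) (A : τ → V) : Qv (Gv A) = A := by
  funext t
  rw [extension_comp g q hGv hQv A t]
  simp_rw [LinearMap.comp_apply, hqg]
  have : ∀ i, (((Pi.single i (1 : ℝ) : τ → ℝ) t : ℝ) : ℂ) • A i = if i = t then A i else 0 := by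
    intro i; by_cases hi : i = t
    · subst hi; simp
    · simp [Ne.symm hi, hi]
  simp_rw [this]
  simp

/-- **«Q𝔊 = 0» TRANSFERS** (p. 294): if `q(gx) = 0` for all real `x` then `q_V(G_V A) = 0` — the hypothesis of
`FlatSmallSolution158.solution158_mem_ker` at the extended operators. [cite: Balaban1985Variational, (108)-(111) p.294] -/
theorem extension_comp_eq_zero [Fintype κ] [DecidableEq κ] {τ : Type*} [Fintype τ] [DecidableEq τ] (g : (ι → ℝ) →ₗ[ℝ] (κ → ℝ)) (q : (κ → ℝ) →ₗ[ℝ] (τ → ℝ))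
    {Gv : (ι → V) →ₗ[ℂ] (κ → V)} {Qv : (κ → V) →ₗ[ℂ] (τ → V)}
    (hGv : ∀ (A : ι → V) (b : κ), Gv A b = ∑ i, ((g (Pi.single i 1) b : ℝ) : ℂ) • A i)
    (hQv : ∀ (B : κ → V) (t : τ), Qv B t = ∑ b, ((q (Pi.single b 1) t : ℝ) : ℂ) • B b)
    (hqg : ∀ x, q (g x) = 0) (A : ι → V) : Qv (Gv A) = 0 := by
  funext t
  rw [extension_comp g q hGv hQv A t]
  simp_rw [LinearMap.comp_apply, hqg]
  simp

/-! ## §2 The transfer of letters (sup bounds, weighted differences, any real linear combination of values) -/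

/-- **THE TRANSFER OF AN ARBITRARY LETTER.**  If the real functional `x ↦ Σ_b λ_b·(gx)(b)` is bounded by `C` on the unit sup-ball of real
fields, then `‖Σ_b λ_b·(G_V A)(b)‖ ≤ C·β` whenever `‖A(i)‖ ≤ β` for all `i`.  Proof: `Σ_b λ_b(G_V A)(b) = Σ_i m(i)·A(i)` with
`m(i) = Σ_b λ_b k(b, i)`, and `Σ_i |m(i)| = Σ_b λ_b (g·sgn m)(b) ≤ C` (the sign trick). [folklore] -/
theorem letter_extension_le [Fintype κ] (g : (ι → ℝ) →ₗ[ℝ] (κ → ℝ)) {Gv : (ι → V) →ₗ[ℂ] (κ → V)}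
    (hGv : ∀ (A : ι → V) (b : κ), Gv A b = ∑ i, ((g (Pi.single i 1) b : ℝ) : ℂ) • A i) (lam : κ → ℝ) {C : ℝ}
    (hg : ∀ x : ι → ℝ, (∀ i, |x i| ≤ 1) → |∑ b, lam b * g x b| ≤ C) (A : ι → V) {β : ℝ} (hβ : 0 ≤ β)
    (hA : ∀ i, ‖A i‖ ≤ β) : ‖∑ b, ((lam b : ℝ) : ℂ) • Gv A b‖ ≤ C * β := by
  -- the combined kernel m(i) = Σ_b λ_b k(b,i)
  set m : ι → ℝ := fun i => ∑ b, lam b * g (Pi.single i 1) b with hm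
  have hsum : ∑ b, ((lam b : ℝ) : ℂ) • Gv A b = ∑ i, ((m i : ℝ) : ℂ) • A i := by
    simp_rw [hGv, Finset.smul_sum, smul_smul]
    rw [Finset.sum_comm]
    refine Finset.sum_congr rfl fun i _ => ?_
    rw [← Finset.sum_smul, hm]
    simp only [Complex.ofReal_sum, Complex.ofReal_mul]
  -- Σ_i |m i| ≤ C by the sign trick
  have hsign : ∑ i, |m i| ≤ C := by
    let x : ι → ℝ := fun i => if 0 ≤ m i then 1 else -1
    have hx : ∀ i, |x i| ≤ 1 := fun i => by
      simp only [x]; split_ifs <;> simp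
    have hmx : ∀ i, m i * x i = |m i| := fun i => by
      simp only [x]; split_ifs with h
      · rw [mul_one, abs_of_nonneg h]
      · rw [mul_neg, mul_one, abs_of_neg (not_le.1 h)]
    have hgx : ∑ b, lam b * g x b = ∑ i, m i * x i := by
      simp_rw [apply_eq_sum_kernel g x, Finset.mul_sum]
      rw [Finset.sum_comm]
      refine Finset.sum_congr rfl fun i _ => ?_
      rw [hm]
      simp only [Finset.sum_mul]
      refine Finset.sum_congr rfl fun b _ => ?_
      ring
    calc ∑ i, |m i| = ∑ i, m i * x i := Finset.sum_congr rfl fun i _ => (hmx i).symm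
      _ = ∑ b, lam b * g x b := hgx.symm
      _ ≤ |∑ b, lam b * g x b| := le_abs_self _
      _ ≤ C := hg x hx
  rw [hsum]
  calc ‖∑ i, ((m i : ℝ) : ℂ) • A i‖ ≤ ∑ i, ‖((m i : ℝ) : ℂ) • A i‖ := norm_sum_le _ _
    _ = ∑ i, |m i| * ‖A i‖ := Finset.sum_congr rfl fun i _ => by
        rw [norm_smul, Complex.norm_real, Real.norm_eq_abs]
    _ ≤ ∑ i, |m i| * β := Finset.sum_le_sum fun i _ => mul_le_mul_of_nonneg_left (hA i) (abs_nonneg _)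
    _ = (∑ i, |m i|) * β := (Finset.sum_mul _ _ _).symm
    _ ≤ C * β := mul_le_mul_of_nonneg_right hsign hβ

/-- **SUP LETTER**: `|(gx)(b)| ≤ C·β` for `|x| ≤ β` ⇒ `‖(G_V A)(b)‖ ≤ C·β` for `‖A‖ ≤ β` — (46)/(1.115) first entry at 𝔤ᶜ-valued fields.
[cite: Balaban1985Variational, (46) p.285] -/
theorem sup_extension_le [Fintype κ] [DecidableEq κ] (g : (ι → ℝ) →ₗ[ℝ] (κ → ℝ)) {Gv : (ι → V) →ₗ[ℂ] (κ → V)}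
    (hGv : ∀ (A : ι → V) (b : κ), Gv A b = ∑ i, ((g (Pi.single i 1) b : ℝ) : ℂ) • A i) {C : ℝ}
    (hg : ∀ (x : ι → ℝ) (β : ℝ), (∀ i, |x i| ≤ β) → ∀ b, |g x b| ≤ C * β)
    (A : ι → V) {β : ℝ} (hβ : 0 ≤ β) (hA : ∀ i, ‖A i‖ ≤ β) (b : κ) : ‖Gv A b‖ ≤ C * β := by
  have h := letter_extension_le g hGv (Pi.single b 1) (C := C) (fun x hx => ?_) A hβ hA
  · simpa [Pi.single_apply, Finset.sum_ite_eq', Complex.ofReal_one] using h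
  · have := hg x 1 hx b
    simpa [Pi.single_apply, Finset.sum_ite_eq'] using this

/-- **DIFFERENCE LETTER**: `c·|(gx)(b₁) − (gx)(b₀)| ≤ C·β` for `|x| ≤ β` ⇒ `c·‖(G_V A)(b₁) − (G_V A)(b₀)‖ ≤ C·β` for `‖A‖ ≤ β` (`c ≥ 0`) —
(46)'s gradient entry / pillar F3's `L^j·|(Hb)(⟨s+e_ν,μ⟩) − (Hb)(⟨s,μ⟩)|` letter at 𝔤ᶜ-valued fields. [cite: Balaban1985Variational, (46) p.285] -/
theorem diff_extension_le [Fintype κ] [DecidableEq κ] (g : (ι → ℝ) →ₗ[ℝ] (κ → ℝ)) {Gv : (ι → V) →ₗ[ℂ] (κ → V)}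
    (hGv : ∀ (A : ι → V) (b : κ), Gv A b = ∑ i, ((g (Pi.single i 1) b : ℝ) : ℂ) • A i) {c C : ℝ} (hc : 0 ≤ c)
    (b₁ b₀ : κ) (hg : ∀ (x : ι → ℝ) (β : ℝ), (∀ i, |x i| ≤ β) → c * |g x b₁ - g x b₀| ≤ C * β)
    (A : ι → V) {β : ℝ} (hβ : 0 ≤ β) (hA : ∀ i, ‖A i‖ ≤ β) : c * ‖Gv A b₁ - Gv A b₀‖ ≤ C * β := by
  -- the letter λ = c·(δ_{b₁} − δ_{b₀})
  set lam : κ → ℝ := fun b => c * ((Pi.single b₁ (1 : ℝ) : κ → ℝ) b - (Pi.single b₀ (1 : ℝ) : κ → ℝ) b) with hlam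
  have hsingleR : ∀ (b' : κ) (F : κ → ℝ), ∑ b, ((Pi.single b' (1 : ℝ) : κ → ℝ) b) * F b = F b' := by
    intro b' F
    have : ∀ b, ((Pi.single b' (1 : ℝ) : κ → ℝ) b) * F b = if b = b' then F b else 0 := by
      intro b; by_cases hb : b = b' <;> simp [hb]
    simp_rw [this]
    simp
  have h := letter_extension_le g hGv lam (C := C) (fun x hx => ?_) A hβ hA
  · have e : ∑ b, ((lam b : ℝ) : ℂ) • Gv A b = (c : ℂ) • (Gv A b₁ - Gv A b₀) := by
      have h1 : ∀ b, ((lam b : ℝ) : ℂ) • Gv A b =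
          (c : ℂ) • (((((Pi.single b₁ (1 : ℝ) : κ → ℝ) b : ℝ) : ℂ) • Gv A b) - ((((Pi.single b₀ (1 : ℝ) : κ → ℝ) b : ℝ) : ℂ) • Gv A b)) := by
        intro b; rw [hlam, Complex.ofReal_mul, ← smul_smul, Complex.ofReal_sub, sub_smul]
      simp_rw [h1, ← Finset.smul_sum, Finset.sum_sub_distrib]
      congr 1
      have e1 : ∑ b, (((Pi.single b₁ (1 : ℝ) : κ → ℝ) b : ℝ) : ℂ) • Gv A b = Gv A b₁ := by
        have : ∀ b, (((Pi.single b₁ (1 : ℝ) : κ → ℝ) b : ℝ) : ℂ) • Gv A b = if b = b₁ then Gv A b else 0 := by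
          intro b; by_cases hb : b = b₁ <;> simp [hb]
        simp_rw [this]; simp
      have e0 : ∑ b, (((Pi.single b₀ (1 : ℝ) : κ → ℝ) b : ℝ) : ℂ) • Gv A b = Gv A b₀ := by
        have : ∀ b, (((Pi.single b₀ (1 : ℝ) : κ → ℝ) b : ℝ) : ℂ) • Gv A b = if b = b₀ then Gv A b else 0 := by
          intro b; by_cases hb : b = b₀ <;> simp [hb]
        simp_rw [this]; simp
      rw [e1, e0]
    rw [e, norm_smul, Complex.norm_real, Real.norm_of_nonneg hc] at h
    exact h
  · have h2 := hg x 1 hx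
    have e : ∑ b, lam b * g x b = c * (g x b₁ - g x b₀) := by
      have h1 : ∀ b, lam b * g x b = c * (((Pi.single b₁ (1 : ℝ) : κ → ℝ) b) * g x b - ((Pi.single b₀ (1 : ℝ) : κ → ℝ) b) * g x b) := by
        intro b; rw [hlam]; ring
      simp_rw [h1, ← Finset.mul_sum, Finset.sum_sub_distrib, hsingleR]
    rw [e, abs_mul, abs_of_nonneg hc]
    simpa using h2

end Generic

/-! ## §3 At the d = 3 carrier: p1 g14's two letters for a scalar flat operator give F4's letters on 𝔤ᶜ-valued fields -/

section T3

open T3ContinuumYM3Torus (T3Family)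

variable {V : Type*} [NormedAddCommGroup V] [NormedSpace ℂ V]

open scoped Classical in
/-- **THE F3 ⟶ F4 JUNCTION AT THE d = 3 CARRIER.**  Let `g` be a REAL-LINEAR operator from scalar bond fields on level `j₁` of `F.P K` to scalar
bond fields on the fine torus (pillar F3's flat `H` for `j₁ = K − n`, or `G̃` for `j₁ = 0`) with p1 g14's two letters: `|gx| ≤ C₀β` and
`L^{K−n}·|(gx)(⟨s+e_ν,μ⟩) − (gx)(⟨s,μ⟩)| ≤ C₁β` whenever `|x| ≤ β`.  Then its componentwise extension `G_V` to `V`-valued fields (`V = 𝔤ᶜ`) is a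
ℂ-linear operator with the SAME two letters in `‖·‖` — exactly the hypotheses `hG` of `FlatSmallSolution158.existsUnique_smallSolution158_T3` (for
`C₀ = C₁ = B₀`) and `hH` of `FlatChart47.chart47_T3` — and it is `g` on each component. [cite: Balaban1985Variational, p.288, (46) p.285, Sect. F p.302] -/
theorem exists_extension_T3 (F : T3Family) (n K j₁ : ℕ) (g : (PBond (F.P K) j₁ → ℝ) →ₗ[ℝ] (PBond (F.P K) 0 → ℝ)) {C₀ C₁ : ℝ}
    (hg₀ : ∀ (x : PBond (F.P K) j₁ → ℝ) (β : ℝ), (∀ c', |x c'| ≤ β) → ∀ b, |g x b| ≤ C₀ * β)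
    (hg₁ : ∀ (x : PBond (F.P K) j₁ → ℝ) (β : ℝ), (∀ c', |x c'| ≤ β) →
      ∀ (s : Site (F.P K) 0) (μ ν : Fin 3), (F.L : ℝ) ^ (K - n) * |g x ⟨s.shift ν, μ⟩ - g x ⟨s, μ⟩| ≤ C₁ * β) :
    ∃ Gv : (PBond (F.P K) j₁ → V) →ₗ[ℂ] (PBond (F.P K) 0 → V),
      (∀ (A : PBond (F.P K) j₁ → V) (b : PBond (F.P K) 0), Gv A b = ∑ i, ((g (Pi.single i 1) b : ℝ) : ℂ) • A i) ∧
      (∀ (x : PBond (F.P K) j₁ → ℝ) (v : V), Gv (fun i => ((x i : ℝ) : ℂ) • v) = fun b => ((g x b : ℝ) : ℂ) • v) ∧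
      ∀ (A : PBond (F.P K) j₁ → V) (β : ℝ), (∀ c', ‖A c'‖ ≤ β) →
        (∀ b, ‖Gv A b‖ ≤ C₀ * β) ∧
          ∀ (s : Site (F.P K) 0) (μ ν : Fin 3), (F.L : ℝ) ^ (K - n) * ‖Gv A ⟨s.shift ν, μ⟩ - Gv A ⟨s, μ⟩‖ ≤ C₁ * β := by
  classical
  obtain ⟨Gv, hGv⟩ := exists_extension g V
  have hL : (0 : ℝ) ≤ (F.L : ℝ) ^ (K - n) := pow_nonneg (Nat.cast_nonneg _) _
  refine ⟨Gv, hGv, fun x v => extension_apply_real_smul g hGv x v, fun A β hA => ?_⟩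
  have hβ : 0 ≤ β := (norm_nonneg _).trans (hA ⟨default, ⟨0, (F.P K).hd⟩⟩)
  exact ⟨fun b => sup_extension_le g hGv hg₀ A hβ hA b,
    fun s μ ν => diff_extension_le g hGv hL ⟨s.shift ν, μ⟩ ⟨s, μ⟩ (fun x β' hx => hg₁ x β' hx s μ ν) A hβ hA⟩

end T3

end Summit.QuantumFields.YangMills.Theorems.FlatScalarExtension

end
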